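import Summits.ValiantsHypothesis.ValiantsHypothesis.Theorems.LacunarySymmetroidMatrixDescartesCensusSecularRolle
import Summits.ValiantsHypothesis.ValiantsHypothesis.Theorems.LacunarySymmetroidMatrixDescartesCensusPivotDefs
import Literature.LinearAlgebra.Matrix.ConverseInterlacing

/-!
# `MatrixDescartes` (stmt-ValiantsHypothesis-18050) — pivot column at index one: THE INFLECTION BOUND
# `Z₊(det F) ≤ 2 + Z₊(𝔖)`, with the DENT DISCRIMINANT `𝔖(N, D)` free of the pivot exponent AND of the negative eigenvalue

HONEST FRAMING.  Cell `pub-symmetroid`, seat `val-sym-mdr-p2` (gen 23); helper file `--supports` the crux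
`Theses.LacunarySymmetroid.MatrixDescartes` (OPEN), NO closure claim.  Structure theorem for conjb-1's index-one pivot column
(`…CensusPivotDefs`: `Pivot.PivotRootLawAt m K 1 B`, the typed open rungs R1″/R1‴/R1‴b/R1′) on top of conjb-1 g2's SECULAR ROLLE
(`…CensusSecularRolle`, `SecularRolle.secularRolle`: `Z₊(D − X^e N) ≤ 1 + Z₊(W_e(N, D))`, `W_e` the twisted Wronskian).  Nothing here
bears on `MatrixDescartes` in its window, on `stub_twoSided`, on `DoorA26` / `DoorA34`, the census registers, or `VP ≠ VNP`.

CONTENT.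
§1 (polynomials).  A SECOND Rolle step, applied to the mean-frequency gap `R = θ log D − θ log N` (`θ = X·d/dX`) whose level set
`{R = e}` is the zero set of `W_e`, gives the **INFLECTION BOUND**
  `Z₊(D − X^e·N) ≤ Z₊(𝔖(N, D)) + 2`,   `𝔖(N, D) := X·(U·(N D)′ − U′·(N D))`,  `U := X·(N′ D − N D′) = W₀(N, D)`
(`posRootCount_sub_X_pow_mul_le_dent_add_two`), valid for all real polynomials `N, D` WITHOUT positive zeros and EVERY `e : ℕ`.
The dent discriminant `𝔖` does not depend on `e` (`twistedWronskian_zero_shift`: `W₀(N D − W_e(N,D), N D) = 𝔖(N, D)` for every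
`e`), is homogeneous under `N ↦ c·N` (`dent_C_mul`, so the bound is uniform in the LEVEL as well: `posRootCount_sub_X_pow_C_mul_le`),
and is antisymmetric in `(N, D)` (`dent_swap`).  Its positive zeros are the critical points of `R`, i.e. the INFLECTION POINTS of
`ψ(t) = log N(eᵗ) − log D(eᵗ)` — the boundaries of conjb-1's «dents» (ROUND2-MEMO §1, §5b: «roots ≤ 2·#dents + 2», there informal).
§2 (index-one pivot pencils).  For `F = X^e (A − w wᵀ) + ∑ₖ X^{dₖ} Pₖ` (`A = J + w wᵀ`; this is the general pivot pencil of index `≤ 1`)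
Cauchy's rank-one determinant formula over `ℝ[X]` (tree `Literature.LinearAlgebra.Matrix.det_add_vecMulVec_adjugate`) gives
`det F = det 𝔻 − X^e·N` with the PSD SKELETON `𝔻 = X^e A + ∑ X^{dₖ} Pₖ` and `N = wᵀ adj(𝔻) w` (`det_pivot_eq_skeleton_sub`), hence
  **`pivotPosRoots e d J P ≤ posRootCount (𝔖(N, det 𝔻)) + 2`**  (`pivotPosRoots_le_dent_add_two`)
whenever `det 𝔻` and `N` have no positive zero (automatic when `A + ∑ Pₖ ≻ 0` and `w ≠ 0`; here taken as hypotheses on the two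
polynomials) — ONE e-free, level-free polynomial of the skeleton `(𝔻, w)` controls every index-one pencil built on it.
LOCATED, NOT CLAIMED (seat memo DENT-CENSUS.md, exact-sign annealing, pure python): the number of positive zeros of `𝔖` — the inflection
count of `ψ` — reaches and never exceeded `2(m−1)(L−1)` (`L` = number of letters of `𝔻`) in the cells `(m, L) ∈ {2}×{2,…,5} ∪ {3}×{2,3,4}
∪ {4}×{2,3}`; `Z₊(𝔖) ≤ 2(m−1)(L−1)` would give R1‴b `RankOnePivotLawBilinearWeak` (`2(m−1)K + 2`) by this file.  OPEN.

[folklore] Rolle's theorem twice (tree `SecularRolle.secularRolle`), Cauchy's formula `det(A + x yᵀ) = det A + yᵀ adj(A) x`.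
Axioms `propext`, `Classical.choice`, `Quot.sound`.
-/

set_option linter.dupNamespace false

namespace Summit.ValiantsHypothesis.ValiantsHypothesis.Theorems.LacunarySymmetroidMatrixDescartes.SecularRolle

open Polynomial Matrix Finset
open scoped BigOperators

/-! ### §1. The dent discriminant and the inflection bound -/

/-- **The dent discriminant** `𝔖[N, D] := X·(U·(N·D)′ − U′·(N·D))` with `U := W₀(N, D) = X·(N′D − N D′)` — LOCAL NOTATION
(no definition is introduced; every statement below carries the expression itself).  On `(0, ∞)`,
`𝔖 /(N D)² = X · d/dX (U/(N D)) = θ(θ log N − θ log D)`: its positive zeros are the critical points of the mean-frequency gap,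
i.e. the inflection points of `ψ(t) = log N(eᵗ) − log D(eᵗ)`. -/
local notation3 (prettyPrint := false) "𝔖[" N ", " D "]" =>
  (X : ℝ[X]) * (twistedWronskian 0 N D * derivative (N * D) - derivative (twistedWronskian 0 N D) * (N * D))

/-- `W_e(N, D) = e·N·D + W₀(N, D)`. [folklore] -/
theorem twistedWronskian_eq_add_zero (e : ℕ) (N D : ℝ[X]) :
    twistedWronskian e N D = C (e : ℝ) * (N * D) + twistedWronskian 0 N D := by
  simp [twistedWronskian]

/-- **`𝔖` is free of the pivot exponent**: `W₀(N D − W_e(N, D), N D) = 𝔖(N, D)` for every `e`. [folklore] -/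
theorem twistedWronskian_zero_shift (e : ℕ) (N D : ℝ[X]) :
    twistedWronskian 0 (N * D - twistedWronskian e N D) (N * D) = 𝔖[N, D] := by
  rw [twistedWronskian_eq_add_zero e N D]
  unfold twistedWronskian
  simp only [Nat.cast_zero, map_zero, zero_mul, zero_add, derivative_sub, derivative_add, derivative_mul,
    derivative_C, zero_mul, zero_add, derivative_X, one_mul]
  ring

/-- Level homogeneity: `𝔖(c·N, D) = c²·𝔖(N, D)`. [folklore] -/
theorem dent_C_mul (c : ℝ) (N D : ℝ[X]) : 𝔖[C c * N, D] = C (c ^ 2) * 𝔖[N, D] := by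
  unfold twistedWronskian
  simp only [Nat.cast_zero, map_zero, zero_mul, zero_add, derivative_sub, derivative_mul,
    derivative_C, derivative_X, one_mul, map_pow]
  ring

/-- Antisymmetry: `𝔖(D, N) = −𝔖(N, D)` (the count is symmetric in the two posynomials). [folklore] -/
theorem dent_swap (N D : ℝ[X]) : 𝔖[D, N] = -𝔖[N, D] := by
  unfold twistedWronskian
  simp only [Nat.cast_zero, map_zero, zero_mul, zero_add, derivative_sub, derivative_mul, derivative_X, one_mul]
  ring

/-- `Z₊(−f) = Z₊(f)`. [folklore] -/
theorem posRootCount_neg (f : ℝ[X]) : posRootCount (-f) = posRootCount f := by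
  unfold posRootCount; rw [roots_neg]

/-- `Z₊(c·f) = Z₊(f)` for `c ≠ 0`. [folklore] -/
theorem posRootCount_C_mul (f : ℝ[X]) {c : ℝ} (hc : c ≠ 0) : posRootCount (C c * f) = posRootCount f := by
  unfold posRootCount; rw [roots_C_mul _ hc]

/-- **THE INFLECTION BOUND (two Rolle steps).**  For real polynomials `N, D` without positive zeros and every `e : ℕ`:
`Z₊(D − X^e·N) ≤ Z₊(𝔖(N, D)) + 2`.  First step: the tree's secular Rolle `Z₊(D − X^e N) ≤ Z₊(W_e) + 1`; second step: the same
lemma at exponent `0` for the pair `(N D − W_e, N D)`, whose twisted Wronskian is `𝔖(N, D)` for every `e`. [folklore] -/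
theorem posRootCount_sub_X_pow_mul_le_dent_add_two (e : ℕ) (N D : ℝ[X])
    (hN : ∀ x : ℝ, 0 < x → N.eval x ≠ 0) (hD : ∀ x : ℝ, 0 < x → D.eval x ≠ 0) :
    posRootCount (D - X ^ e * N) ≤ posRootCount 𝔖[N, D] + 2 := by
  have h1 := secularRolle e N D hD
  have hND : ∀ x : ℝ, 0 < x → (N * D).eval x ≠ 0 := fun x hx => by
    rw [eval_mul]; exact mul_ne_zero (hN x hx) (hD x hx)
  have h2 := secularRolle 0 (N * D - twistedWronskian e N D) (N * D) hND
  rw [pow_zero, one_mul, sub_sub_cancel, twistedWronskian_zero_shift] at h2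
  omega

/-- **Uniform in the level**: `Z₊(D − X^e·(c·N)) ≤ Z₊(𝔖(N, D)) + 2` for every `c ≠ 0` — one polynomial `𝔖(N, D)` bounds the
whole two-parameter family of levels `c` and pivot exponents `e`. [folklore] -/
theorem posRootCount_sub_X_pow_C_mul_le (e : ℕ) {c : ℝ} (hc : c ≠ 0) (N D : ℝ[X])
    (hN : ∀ x : ℝ, 0 < x → N.eval x ≠ 0) (hD : ∀ x : ℝ, 0 < x → D.eval x ≠ 0) :
    posRootCount (D - X ^ e * (C c * N)) ≤ posRootCount 𝔖[N, D] + 2 := by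
  have hcN : ∀ x : ℝ, 0 < x → (C c * N).eval x ≠ 0 := fun x hx => by
    rw [eval_mul, eval_C]; exact mul_ne_zero hc (hN x hx)
  have h := posRootCount_sub_X_pow_mul_le_dent_add_two e (C c * N) D hcN hD
  rwa [dent_C_mul, posRootCount_C_mul _ (pow_ne_zero 2 hc)] at h

/-! ### §2. Index-one pivot pencils: `det F = det 𝔻 − X^e·N` and the inflection bound in pivot currency -/

section Pivot

variable {m K : ℕ}

/-- The PSD SKELETON `𝔻 = X^e A + ∑ₖ X^{dₖ} Pₖ` of the pivot pencil `X^e (A − w wᵀ) + ∑ₖ X^{dₖ} Pₖ` (local notation). -/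
local notation3 (prettyPrint := false) "𝔻[" e ", " d ", " A ", " P "]" =>
  ((X : ℝ[X]) ^ (e : ℕ)) • (A : Matrix (Fin _) (Fin _) ℝ).map Polynomial.C
    + ∑ k, ((X : ℝ[X]) ^ (d : Fin _ → ℕ) k) • ((P : Fin _ → Matrix (Fin _) (Fin _) ℝ) k).map Polynomial.C

/-- The RESOLVENT NUMERATOR `N = wᵀ adj(𝔻) w ∈ ℝ[X]` (local notation). -/
local notation3 (prettyPrint := false) "ℕ𝕨[" e ", " d ", " A ", " P ", " w "]" =>
  (fun i => Polynomial.C ((w : Fin _ → ℝ) i)) ⬝ᵥ ((𝔻[e, d, A, P]).adjugate *ᵥ fun i => Polynomial.C ((w : Fin _ → ℝ) i))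

/-- The pivot pencil is a rank-one perturbation of its skeleton:
`X^e (A − w wᵀ) + ∑ X^{dₖ} Pₖ = 𝔻 + (−X^e·w) wᵀ` over `ℝ[X]`. [folklore] -/
theorem pivot_pencil_eq_skeleton_add_vecMulVec (e : ℕ) (d : Fin K → ℕ) (A : Matrix (Fin m) (Fin m) ℝ)
    (w : Fin m → ℝ) (P : Fin K → Matrix (Fin m) (Fin m) ℝ) :
    ((X : ℝ[X]) ^ e) • (A - vecMulVec w w).map Polynomial.C + ∑ k, ((X : ℝ[X]) ^ d k) • (P k).map Polynomial.C
      = 𝔻[e, d, A, P] + vecMulVec (fun i => -((X : ℝ[X]) ^ e * Polynomial.C (w i))) (fun i => Polynomial.C (w i)) := by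
  ext i j
  simp only [Matrix.add_apply, Matrix.smul_apply, Matrix.map_apply, Matrix.sub_apply, vecMulVec_apply, map_sub,
    map_mul, smul_eq_mul]
  ring

/-- **Cauchy's formula for the pivot pencil**: `det (X^e (A − w wᵀ) + ∑ X^{dₖ} Pₖ) = det 𝔻 − X^e · wᵀ adj(𝔻) w` in `ℝ[X]`
(Horn–Johnson (0.8.5.11); tree `Literature.LinearAlgebra.Matrix.det_add_vecMulVec_adjugate`, no invertibility needed). [folklore] -/
theorem det_pivot_eq_skeleton_sub (e : ℕ) (d : Fin K → ℕ) (A : Matrix (Fin m) (Fin m) ℝ)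
    (w : Fin m → ℝ) (P : Fin K → Matrix (Fin m) (Fin m) ℝ) :
    Matrix.det (((X : ℝ[X]) ^ e) • (A - vecMulVec w w).map Polynomial.C + ∑ k, ((X : ℝ[X]) ^ d k) • (P k).map Polynomial.C)
      = Matrix.det (𝔻[e, d, A, P]) - (X : ℝ[X]) ^ e * ℕ𝕨[e, d, A, P, w] := by
  rw [pivot_pencil_eq_skeleton_add_vecMulVec, Literature.LinearAlgebra.Matrix.det_add_vecMulVec_adjugate]
  have hx : (fun i => -((X : ℝ[X]) ^ e * Polynomial.C (w i))) = -((X : ℝ[X]) ^ e • fun i => Polynomial.C (w i)) := by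
    ext i; simp [smul_eq_mul]
  rw [hx, Matrix.mulVec_neg, Matrix.mulVec_smul, dotProduct_neg, dotProduct_smul, smul_eq_mul, sub_eq_add_neg]

/-- **THE INFLECTION BOUND FOR INDEX-ONE PIVOT PENCILS.**  For `F = X^e (A − w wᵀ) + ∑ₖ X^{dₖ} Pₖ` whose skeleton determinant
`det 𝔻` and resolvent numerator `N = wᵀ adj(𝔻) w` have no positive zero (automatic for `A + ∑ Pₖ ≻ 0`, `Pₖ, A ⪰ 0`, `w ≠ 0`):
`Z₊(det F) ≤ Z₊(𝔖[N, det 𝔻]) + 2` — the dent discriminant of the skeleton, free of `e` and of the size of `w wᵀ` along `w`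
(`posRootCount_sub_X_pow_C_mul_le`), bounds the distinct positive determinant roots up to `2`. [folklore] -/
theorem posRootCount_det_pivot_le_dent_add_two (e : ℕ) (d : Fin K → ℕ) (A : Matrix (Fin m) (Fin m) ℝ)
    (w : Fin m → ℝ) (P : Fin K → Matrix (Fin m) (Fin m) ℝ)
    (hD : ∀ x : ℝ, 0 < x → (Matrix.det (𝔻[e, d, A, P])).eval x ≠ 0)
    (hN : ∀ x : ℝ, 0 < x → (ℕ𝕨[e, d, A, P, w]).eval x ≠ 0) :
    posRootCount (Matrix.det (((X : ℝ[X]) ^ e) • (A - vecMulVec w w).map Polynomial.C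
        + ∑ k, ((X : ℝ[X]) ^ d k) • (P k).map Polynomial.C))
      ≤ posRootCount 𝔖[ℕ𝕨[e, d, A, P, w], Matrix.det (𝔻[e, d, A, P])] + 2 := by
  rw [det_pivot_eq_skeleton_sub]
  exact posRootCount_sub_X_pow_mul_le_dent_add_two e _ _ hN hD

/-- A width-one Gram matrix is an outer square: `W Wᵀ = w wᵀ` with `w = W · 0`. [folklore] -/
theorem mul_transpose_width_one (W : Matrix (Fin m) (Fin 1) ℝ) :
    W * Wᵀ = vecMulVec (fun i => W i 0) (fun i => W i 0) := by
  ext i j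
  simp [Matrix.mul_apply, vecMulVec_apply]

/-- **PIVOT CURRENCY** (`…CensusPivotDefs`).  For a pivot pencil `X^e J + ∑ₖ X^{dₖ} Pₖ` and ANY `w : Fin m → ℝ` (for pivot
index `≤ 1` take `w = W · 0` with `J + W Wᵀ ⪰ 0`, `mul_transpose_width_one`, so that the skeleton letter `A = J + w wᵀ` is PSD):
with `A := J + w wᵀ`, if `det 𝔻` and `N = wᵀ adj(𝔻) w` have no positive zero then
`pivotPosRoots e d J P ≤ Z₊(𝔖[N, det 𝔻]) + 2`.  (No semidefiniteness is used by the inequality itself; it is the hypotheses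
`det 𝔻 ≠ 0`, `N ≠ 0` on `(0,∞)` that the PSD skeleton delivers.) [folklore] -/
theorem pivotPosRoots_le_dent_add_two (e : ℕ) (d : Fin K → ℕ) (J : Matrix (Fin m) (Fin m) ℝ)
    (P : Fin K → Matrix (Fin m) (Fin m) ℝ) (w : Fin m → ℝ)
    (hD : ∀ x : ℝ, 0 < x → (Matrix.det (𝔻[e, d, (J + vecMulVec w w), P])).eval x ≠ 0)
    (hN : ∀ x : ℝ, 0 < x → (ℕ𝕨[e, d, (J + vecMulVec w w), P, w]).eval x ≠ 0) :
    Pivot.pivotPosRoots e d J P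
      ≤ posRootCount 𝔖[ℕ𝕨[e, d, (J + vecMulVec w w), P, w], Matrix.det (𝔻[e, d, (J + vecMulVec w w), P])] + 2 := by
  have hJ : J = (J + vecMulVec w w) - vecMulVec w w := (add_sub_cancel_right J _).symm
  have h := posRootCount_det_pivot_le_dent_add_two e d (J + vecMulVec w w) w P hD hN
  rw [← hJ] at h
  unfold Pivot.pivotPosRoots
  exact h

/-! ### §3. The hypotheses from the PSD skeleton: `A + ∑ Pₖ ≻ 0`, letters `⪰ 0`, `w ≠ 0` -/

/-- Evaluating the skeleton at a real point. [folklore] -/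
theorem skeleton_map_eval (e : ℕ) (d : Fin K → ℕ) (A : Matrix (Fin m) (Fin m) ℝ)
    (P : Fin K → Matrix (Fin m) (Fin m) ℝ) (x : ℝ) :
    (𝔻[e, d, A, P]).map (Polynomial.eval x) = x ^ e • A + ∑ k, x ^ d k • P k := by
  ext i j
  simp only [Matrix.map_apply, Matrix.add_apply, Matrix.smul_apply, Matrix.sum_apply, smul_eq_mul,
    Polynomial.eval_add, Polynomial.eval_finsetSum, Polynomial.eval_mul, Polynomial.eval_pow, Polynomial.eval_X,
    Polynomial.eval_C]

/-- `(det 𝔻)(x) = det 𝔻(x)`. [folklore] -/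
theorem det_skeleton_eval (e : ℕ) (d : Fin K → ℕ) (A : Matrix (Fin m) (Fin m) ℝ)
    (P : Fin K → Matrix (Fin m) (Fin m) ℝ) (x : ℝ) :
    (Matrix.det (𝔻[e, d, A, P])).eval x = Matrix.det (x ^ e • A + ∑ k, x ^ d k • P k) := by
  rw [← skeleton_map_eval e d A P x, ← Polynomial.coe_evalRingHom, RingHom.map_det, RingHom.mapMatrix_apply]

/-- `N(x) = wᵀ adj(𝔻(x)) w`. [folklore] -/
theorem numerator_eval (e : ℕ) (d : Fin K → ℕ) (A : Matrix (Fin m) (Fin m) ℝ) (w : Fin m → ℝ)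
    (P : Fin K → Matrix (Fin m) (Fin m) ℝ) (x : ℝ) :
    (ℕ𝕨[e, d, A, P, w]).eval x = w ⬝ᵥ ((x ^ e • A + ∑ k, x ^ d k • P k).adjugate *ᵥ w) := by
  have hadj : ∀ i j, ((𝔻[e, d, A, P]).adjugate i j).eval x = (x ^ e • A + ∑ k, x ^ d k • P k).adjugate i j := by
    intro i j
    have h := RingHom.map_adjugate (Polynomial.evalRingHom x) (𝔻[e, d, A, P])
    rw [RingHom.mapMatrix_apply, RingHom.mapMatrix_apply, Polynomial.coe_evalRingHom, skeleton_map_eval] at h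
    have hij := congrFun (congrFun h i) j
    rw [Matrix.map_apply] at hij
    exact hij
  simp only [dotProduct, Matrix.mulVec, Polynomial.eval_finsetSum, Polynomial.eval_mul, Polynomial.eval_C, hadj]

/-- **The skeleton is positive definite on `(0, ∞)`** when its letters are PSD and their sum is PD. [folklore] -/
theorem skeleton_posDef (e : ℕ) (d : Fin K → ℕ) {A : Matrix (Fin m) (Fin m) ℝ}
    {P : Fin K → Matrix (Fin m) (Fin m) ℝ} (hA : A.PosSemidef) (hP : ∀ k, (P k).PosSemidef)
    (hpd : (A + ∑ k, P k).PosDef) {x : ℝ} (hx : 0 < x) :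
    (x ^ e • A + ∑ k, x ^ d k • P k).PosDef := by
  have hpsd : (x ^ e • A + ∑ k, x ^ d k • P k).PosSemidef :=
    (hA.smul (pow_nonneg hx.le e)).add
      (posSemidef_sum Finset.univ fun k _ => (hP k).smul (pow_nonneg hx.le (d k)))
  refine PosDef.of_dotProduct_mulVec_pos hpsd.1 fun v hv => ?_
  refine lt_of_le_of_ne (hpsd.dotProduct_mulVec_nonneg v) fun h0 => ?_
  -- if the form vanishes, every (nonnegative) term vanishes, contradicting `A + ∑ Pₖ ≻ 0`
  have hsplit : star v ⬝ᵥ ((x ^ e • A + ∑ k, x ^ d k • P k) *ᵥ v)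
      = x ^ e * (star v ⬝ᵥ (A *ᵥ v)) + ∑ k, x ^ d k * (star v ⬝ᵥ (P k *ᵥ v)) := by
    simp only [Matrix.add_mulVec, Matrix.smul_mulVec, dotProduct_add, dotProduct_smul, smul_eq_mul,
      Matrix.sum_mulVec, dotProduct_sum]
  have hA0 : 0 ≤ x ^ e * (star v ⬝ᵥ (A *ᵥ v)) := mul_nonneg (pow_nonneg hx.le e) (hA.dotProduct_mulVec_nonneg v)
  have hP0 : ∀ k ∈ Finset.univ, 0 ≤ x ^ d k * (star v ⬝ᵥ (P k *ᵥ v)) :=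
    fun k _ => mul_nonneg (pow_nonneg hx.le (d k)) ((hP k).dotProduct_mulVec_nonneg v)
  rw [hsplit] at h0
  have hsum0 : ∑ k, x ^ d k * (star v ⬝ᵥ (P k *ᵥ v)) = 0 := by
    have h1 := Finset.sum_nonneg hP0
    linarith
  have hA00 : star v ⬝ᵥ (A *ᵥ v) = 0 := by
    have h1 := Finset.sum_nonneg hP0
    have h2 : x ^ e * (star v ⬝ᵥ (A *ᵥ v)) = 0 := by linarith
    rcases mul_eq_zero.mp h2 with h | h
    · exact absurd h (pow_ne_zero e hx.ne')
    · exact h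
  have hPk : ∀ k, star v ⬝ᵥ (P k *ᵥ v) = 0 := fun k => by
    have h := (Finset.sum_eq_zero_iff_of_nonneg hP0).mp hsum0 k (Finset.mem_univ k)
    rcases mul_eq_zero.mp h with h' | h'
    · exact absurd h' (pow_ne_zero (d k) hx.ne')
    · exact h'
  have hpos := hpd.dotProduct_mulVec_pos hv
  have : star v ⬝ᵥ ((A + ∑ k, P k) *ᵥ v) = 0 := by
    simp only [Matrix.add_mulVec, dotProduct_add, Matrix.sum_mulVec, dotProduct_sum, hA00, hPk,
      Finset.sum_const_zero, add_zero]
  rw [this] at hpos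
  exact lt_irrefl _ hpos

/-- `adj M = det M • M⁻¹` for an invertible real matrix. [folklore] -/
theorem adjugate_eq_det_smul_inv {M : Matrix (Fin m) (Fin m) ℝ} (hM : IsUnit M.det) :
    M.adjugate = M.det • M⁻¹ := by
  have h := Matrix.mul_adjugate M
  calc M.adjugate = M⁻¹ * (M * M.adjugate) := by rw [← Matrix.mul_assoc, Matrix.nonsing_inv_mul _ hM, Matrix.one_mul]
    _ = M.det • M⁻¹ := by rw [h, Matrix.mul_smul, Matrix.mul_one]

/-- **The PSD skeleton delivers both hypotheses**: for `A, Pₖ ⪰ 0` with `A + ∑ Pₖ ≻ 0` and `w ≠ 0`, `det 𝔻` and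
`N = wᵀ adj(𝔻) w` have no positive zero (`N(x) = det 𝔻(x) · wᵀ 𝔻(x)⁻¹ w > 0`). [folklore] -/
theorem skeleton_hypotheses (e : ℕ) (d : Fin K → ℕ) {A : Matrix (Fin m) (Fin m) ℝ} {w : Fin m → ℝ}
    {P : Fin K → Matrix (Fin m) (Fin m) ℝ} (hA : A.PosSemidef) (hP : ∀ k, (P k).PosSemidef)
    (hpd : (A + ∑ k, P k).PosDef) (hw : w ≠ 0) :
    (∀ x : ℝ, 0 < x → (Matrix.det (𝔻[e, d, A, P])).eval x ≠ 0)
      ∧ (∀ x : ℝ, 0 < x → (ℕ𝕨[e, d, A, P, w]).eval x ≠ 0) := by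
  have key : ∀ x : ℝ, 0 < x →
      Matrix.det (x ^ e • A + ∑ k, x ^ d k • P k) ≠ 0
        ∧ w ⬝ᵥ ((x ^ e • A + ∑ k, x ^ d k • P k).adjugate *ᵥ w) ≠ 0 := by
    intro x hx
    have hD := skeleton_posDef e d hA hP hpd hx
    have hdet : IsUnit (x ^ e • A + ∑ k, x ^ d k • P k).det := (Matrix.isUnit_iff_isUnit_det _).mp hD.isUnit
    refine ⟨hdet.ne_zero, ?_⟩
    rw [adjugate_eq_det_smul_inv hdet, Matrix.smul_mulVec, dotProduct_smul, smul_eq_mul]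
    refine mul_ne_zero hdet.ne_zero (ne_of_gt ?_)
    have h := hD.inv.dotProduct_mulVec_pos hw
    simpa using h
  exact ⟨fun x hx => by rw [det_skeleton_eval]; exact (key x hx).1,
    fun x hx => by rw [numerator_eval]; exact (key x hx).2⟩

/-- **THE INFLECTION BOUND FROM THE PSD SKELETON** (the hypotheses of `posRootCount_det_pivot_le_dent_add_two`
discharged): `A, Pₖ ⪰ 0`, `A + ∑ Pₖ ≻ 0`, `w ≠ 0` ⇒ `Z₊(det (X^e (A − w wᵀ) + ∑ X^{dₖ} Pₖ)) ≤ Z₊(𝔖[N, det 𝔻]) + 2`.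
(`A + ∑ Pₖ` singular is the degenerate corner: a common kernel vector of all letters makes `det F ≡ 0` or splits off.) [folklore] -/
theorem posRootCount_det_pivot_le_of_posDef (e : ℕ) (d : Fin K → ℕ) {A : Matrix (Fin m) (Fin m) ℝ}
    {w : Fin m → ℝ} {P : Fin K → Matrix (Fin m) (Fin m) ℝ} (hA : A.PosSemidef) (hP : ∀ k, (P k).PosSemidef)
    (hpd : (A + ∑ k, P k).PosDef) (hw : w ≠ 0) :
    posRootCount (Matrix.det (((X : ℝ[X]) ^ e) • (A - vecMulVec w w).map Polynomial.C
        + ∑ k, ((X : ℝ[X]) ^ d k) • (P k).map Polynomial.C))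
      ≤ posRootCount 𝔖[ℕ𝕨[e, d, A, P, w], Matrix.det (𝔻[e, d, A, P])] + 2 := by
  obtain ⟨hD, hN⟩ := skeleton_hypotheses e d hA hP hpd hw
  exact posRootCount_det_pivot_le_dent_add_two e d A w P hD hN

end Pivot

end Summit.ValiantsHypothesis.ValiantsHypothesis.Theorems.LacunarySymmetroidMatrixDescartes.SecularRolle
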